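import Summits.Ventures.QEC.Census.TwoBGA.TB_l6m24_A0_0_0_1_3_11_B0_0_1_11_5_4.Q144.L1Rows
import Summits.Ventures.QEC.Census.CertBZPlaneAllow
import Summits.Ventures.QEC.Census.CertBZPlaneTop
import HarnessLib

set_option Elab.async false
set_option maxRecDepth 200000

/-!
# `quotient-[[144,12,d_Z≥8]]` one-level cover certificate of `TB_l6m24_A0_0_0_1_3_11_B0_0_1_11_5_4.Q144` — LEVEL-1 list, matrix 0 (depth 3): lane families e0_36_nil … e0_36_nil
(1 families, 7807 lanes, 26 straggler visits; est. 5 s kernel; qec-search-1 g5).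
Each family = qec-search-5 `Plane.topOK` (qec-type-01 lane engine) with the top rows `≥ c` FIXED to `P` and `≤ 3 − |P|` free rows
below the cut `c` (a leaf of the adaptive split tree of `L1Tree0*`), STATED against the full level-1 list `eOrb` and PROVED by
`Plane.topOK_mono_allow` from a `decide +kernel` replay against the family's OWN list of met words (a literal `a_<family>`, data),
every such list re-derived in ONE kernel pass per file as a sub-list of `eOrb.filter (· &&& M = V)` — the listed words whose
information pattern on `T_0` has top part `P` (`M` = the columns `T_0[c…35]`, `V` = the columns `T_0[P]`; `<module>_mem`).
Data (allow-lists) + decided checks; tier KERNEL; axioms standard. Generated by qec-search-1 g5 gen/gen_l1.py (generic port of search-9 g6 `gen_l1.py`; pattern of `L1Enum*` p537336 ff.).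
-/

namespace Summit.Ventures.QEC.Census.TB_l6m24_A0_0_0_1_3_11_B0_0_1_11_5_4.Q144

open Summit.Ventures.QEC.Census

/-- The 26 listed words met by family `e0_36_nil` (pattern on `T_0`: top part `[]` above the cut `36`, `≤ 3` bits), ascending; ⊆ `eOrb` by `L1Enum0A_mem*`. -/
def a_e0_36_nil : List ℕ :=
  [0x400300400000a0, 0x180008010108000, 0x300010020210000, 0x600020001420000, 0x800018800000050, 0x1000c00000002801, 0x3000100202100000, 0x6000200404200000, 0xc000400808400000, 0x10000300000020210, 0x18000800050800000, 0x20000600000001420, 0x21000080101080000, 0x300000400a0040000, 0x400300000000a0040, 0x80021000000101080, 0xc0004000084000008, 0x100003000000202100, 0x180008000108000010, 0x200006000000404200, 0x300010000210000020, 0x40000c000000808400, 0x600020000420000001, 0x800018000000050800, 0x840002000042000004, 0xc00001000801000002]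

set_option maxHeartbeats 400000000 in
/-- MEMBERSHIP group 0 (one kernel pass over `eOrb`): the allow-lists of families e0_36_nil … e0_36_nil are contained in
`eOrb.filter (top pattern of the family)` (raw `Nat.land`/`Nat.beq` mask test `w &&& M = V`). -/
theorem L1Enum0A_mem0 :
    ((TB_l6m24_A0_0_0_1_3_11_B0_0_1_11_5_4.Q144.a_e0_36_nil).all fun w => (eOrb.filter fun w => Nat.beq (Nat.land w 0x0) 0x0).elem w) = true := by
  decide +kernel

set_option maxHeartbeats 400000000 in
/-- Matrix 0, cut `c = 36`, top rows `[]`, `≤ 3` free rows below the cut (7807 lanes) against the full list `eOrb`: REPLAY against the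
family's own 26-word list (qec-search-5 `topOK`, `decide +kernel`) lifted by CertBZPlaneAllow monotonicity (sub-list by `L1Enum0A_mem*`). -/
theorem e0_36_nil : Plane.topOK 72 6 TB_l6m24_A0_0_0_1_3_11_B0_0_1_11_5_4.Q144.eOrb (giRows eGb eM0) 36 3 0 [] 42 = true :=
  Plane.topOK_mono_allow (allow := a_e0_36_nil)
    (fun w hw => List.mem_of_mem_filter (List.mem_of_elem_eq_true (List.all_eq_true.1 L1Enum0A_mem0 w hw)))
    (by decide +kernel)


end Summit.Ventures.QEC.Census.TB_l6m24_A0_0_0_1_3_11_B0_0_1_11_5_4.Q144
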